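import Literature.NumberTheory.LFunctions.ZetaLogDerivRHLogPowerBound
import Literature.NumberTheory.LFunctions.SmoothedExplicitFormulaChar
import Literature.NumberTheory.LFunctions.LagariasDifferencedXiCharRHProofs
import Literature.NumberTheory.LFunctions.DirichletLZeroCountingTwoSided
import HarnessLib

/-!
# `L′/L(σ + it, χ) ≪ (log t)^{2−2σ}` for `½ < σ < 1` under GRH(χ) (Littlewood; Montgomery–Vaughan §13.2.1, Exercise 2)

LINE 1 — LABEL: GRH-CONSEQUENCE literature: the Riemann hypothesis for `L(s, χ)` (`χ.RiemannHypothesis`)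
is the explicit hypothesis of the main statement and is never asserted. bears_on: LADDER-RH B-C/B-P
(COLUMN 6, de Branges; cell rh-crit/dbl, corpus C2, the GRH-side input of Lagarias 2005 Thm 5.2 (2),
node La05:T5.2(2)). WHAT THIS IS NOT: a bound for `L′/L` ASSUMING GRH — not evidence for GRH or RH, not a
route; nothing here bears on the truth of RH.

Everything here is PROVED (theorems only; no definitions, no named facts).

## Main statement (namespace `Literature.NumberTheory.LFunctions.LittlewoodGRH`)

* `norm_logDeriv_LFunction_le_log_rpow` — for a primitive `χ` mod `q > 1` satisfying the Riemann
  hypothesis for `L(s, χ)` and a fixed `½ < σ < 1`, there is `C` with `‖L′/L(σ + it, χ)‖ ≤ C (log t)^{2−2σ}`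
  for all `t ≥ 3` — the `χ`-analogue of Titchmarsh's Theorem 14.5 (14.5.1) (tree:
  `LittlewoodRH.norm_logDeriv_zeta_le_log_rpow`, `ZetaLogDerivRHLogPowerBound.lean`), printed as
  Montgomery–Vaughan §13.2.1 Exercise 2 (b) ("Assume GRH … `L′/L(s,χ) ≪ ((log qτ)^{2−2σ} + 1) min(1/|σ−1|, log log qτ)`",
  held copy p. 340), here for fixed `σ` and fixed `χ`. This is the input "`|L′/L(s,χ)| = O((log|T|)^{2−2σ})`
  … follows from a result of Iwaniec and Kowalski" of Lagarias 2005, proof of Theorem 5.2 (2) (arXiv p. 10).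

## Proof

As in `ZetaLogDerivRHLogPowerBound.lean` (Montgomery–Vaughan Thm 13.13's two-scale explicit formula), with
Heath-Brown's exact smoothed explicit formula for `L(s, χ)` (`ExplicitPsiChar.charFordK_eq_explicit`,
`SmoothedExplicitFormulaChar.lean`) in place of Ford's, applied to the three quadratic pieces
`g_a, g_{a+b}, g_{a+2b}` (`SelbergExplicit.quadPiece`) of the two-scale smoothing; kernel
`−2e^{−az}(1−e^{−bz})²/z³` (`LittlewoodRH.comb_fordLaplace₀_eq`). One simplification: for FIXED `σ` the
sum over the zeros needs no partial fraction — under GRH `Re(s−ρ) = σ − ½ =: d` and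
`‖Σ_ρ m(ρ) kernel(s−ρ)‖ ≤ 8e^{−ad} Σ_ρ m(ρ)/|s−ρ|³ ≤ (8e^{−ad}/(d·min(d²,1))) Σ_ρ m(ρ)/(1+(γ−t)²)`,
and `Σ_ρ m(ρ)/(1+(γ−t)²) ≪ log q(|t|+4)` by the unit-window zero count
(`ExplicitPsiChar.exists_sum_window_le`; `exists_tsum_zeroOrder_div_shift_le` below). The Dirichlet
polynomial is `≤ 2b² Σ_{n ≤ xy²} Λ(n) n^{−σ} ≪ (xy²)^{1−σ}/(1−σ)` (`|χ(n)| ≤ 1`, partial summation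
against Chebyshev's `ψ(u) ≤ (log 4 + 4)u`), the trivial zeros contribute `O(1/t³)`
(`ExplicitPsiChar.norm_sum_trivial_le`), the left-line remainder is
`O(e^{−a(σ+5/2)} log q(1+|t|))` (`ExplicitPsiChar.exists_norm_charEFRemainder_le`, via the linearity
`fordLaplace₀_twoScale`). Choice `a = (log 8)/d + 2 log log t`, `b = 1/d`.

## References

* [MontgomeryVaughan2007] H. L. Montgomery, R. C. Vaughan, *Multiplicative Number Theory I*, CUP 2007,
  §13.2 (13.35), Thm 13.13, and §13.2.1 Exercise 2 (held copy pp. 332–333, 340).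
* [Titchmarsh1986] E. C. Titchmarsh, *The Theory of the Riemann Zeta-Function*, 2nd ed., Thm 14.5
  (14.5.1) (the `ζ` case).
* [HeathBrown1992PLMS] D. R. Heath-Brown, Proc. LMS (3) 64 (1992), Lemma 5.1 (the explicit formula used).
* [Lagarias2005] J. C. Lagarias, Acta Arith. 120 (2005) = arXiv:math/0601653, proof of Theorem 5.2 (2)
  (arXiv p. 10). Consumer of record: `lagarias2005_thm_5_2_2_holds` in
  `LagariasDifferencedXiCharSpacingDistributionProofs.lean` (via `norm_logDeriv_LFunction_le_mul_log_of_rh`).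
-/

noncomputable section

open Complex MeasureTheory Set Filter Topology
open scoped Real

namespace Literature.NumberTheory.LFunctions

namespace LittlewoodGRH

open SelbergExplicit ExplicitPsiChar LittlewoodRH

/-! ## A. Chebyshev by partial summation (as in `ZetaLogDerivRHLogPowerBound.lean`, private there) -/

/-- `Σ_{k ≤ n} Λ(k) = ψ(n)` for natural `n`. [folklore] -/
private theorem sum_Icc_vonMangoldt_eq_psi (n : ℕ) :
    ∑ k ∈ Finset.Icc 0 n, (ArithmeticFunction.vonMangoldt k : ℝ) = Chebyshev.psi n := by
  rw [Chebyshev.psi_eq_sum_Icc, Nat.floor_natCast]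

/-- **Chebyshev by partial summation**: `Σ_{1 < n ≤ N} Λ(n) n^{−σ} ≤ (log 4 + 4) N^{1−σ}/(1 − σ)` for
`0 < σ < 1` (`= ψ(N)N^{−σ} + σ∫₁^N ψ(u)u^{−σ−1} du`, `ψ(u) ≤ (log 4 + 4)u`). [folklore] -/
private theorem sum_Ioc_vonMangoldt_mul_rpow_le {σ : ℝ} (hσ0 : 0 < σ) (hσ1 : σ < 1) {N : ℕ}
    (hN : 1 ≤ N) :
    ∑ n ∈ Finset.Ioc 1 N, (ArithmeticFunction.vonMangoldt n : ℝ) * (n : ℝ) ^ (-σ) ≤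
      (Real.log 4 + 4) * (N : ℝ) ^ (1 - σ) / (1 - σ) := by
  set c : ℝ := Real.log 4 + 4 with hc
  have hlog4 : 0 < Real.log 4 := Real.log_pos (by norm_num)
  have hc0 : 0 < c := by rw [hc]; linarith
  have hNr : (1 : ℝ) ≤ N := by exact_mod_cast hN
  have hNpos : (0 : ℝ) < N := by linarith
  have h1σ : 0 < 1 - σ := by linarith
  set g : ℝ → ℝ := fun u ↦ u ^ (-σ) with hg
  have hsum : ∑ n ∈ Finset.Ioc 1 N, (ArithmeticFunction.vonMangoldt n : ℝ) * (n : ℝ) ^ (-σ) =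
      ∑ k ∈ Finset.Ioc 1 N, g k * (ArithmeticFunction.vonMangoldt k : ℝ) := by
    refine Finset.sum_congr rfl fun k _ ↦ ?_
    simp only [hg]; ring
  rw [hsum]
  have hgd : ∀ u : ℝ, 0 < u → HasDerivAt g (-σ * u ^ (-σ - 1)) u := fun u hu ↦ by
    simpa using Real.hasDerivAt_rpow_const (p := -σ) (Or.inl hu.ne')
  have hg_diff : ∀ u ∈ Set.Icc ((1 : ℕ) : ℝ) N, DifferentiableAt ℝ g u := fun u hu ↦
    (hgd u (by simp only [Nat.cast_one] at hu; linarith [hu.1])).differentiableAt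
  have hg_deriv : ∀ u : ℝ, 0 < u → deriv g u = -σ * u ^ (-σ - 1) := fun u hu ↦ (hgd u hu).deriv
  have hcont : ContinuousOn (fun u : ℝ ↦ -σ * u ^ (-σ - 1)) (Set.Icc ((1 : ℕ) : ℝ) N) :=
    continuousOn_const.mul (continuousOn_id.rpow_const fun u hu ↦ Or.inl (by
      simp only [id, Nat.cast_one] at hu ⊢; linarith [hu.1]))
  have hg_int : IntegrableOn (deriv g) (Set.Icc ((1 : ℕ) : ℝ) N) := by
    refine (hcont.integrableOn_Icc).congr_fun (fun u hu ↦ ?_) measurableSet_Icc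
    exact (hg_deriv u (by simp only [Nat.cast_one] at hu; linarith [hu.1])).symm
  have habel := sum_mul_eq_sub_sub_integral_mul' (fun k ↦ (ArithmeticFunction.vonMangoldt k : ℝ))
    hN hg_diff hg_int
  simp_rw [sum_Icc_vonMangoldt_eq_psi] at habel
  rw [habel]
  -- the boundary terms
  have hψN : Chebyshev.psi (N : ℝ) ≤ c * N := Chebyshev.psi_le_const_mul_self hNpos.le
  have hψ1 : Chebyshev.psi ((1 : ℕ) : ℝ) = 0 := by rw [Nat.cast_one]; exact Chebyshev.psi_one
  have hT1 : g N * Chebyshev.psi (N : ℝ) ≤ c * (N : ℝ) ^ (1 - σ) := by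
    have hgN : 0 ≤ g N := Real.rpow_nonneg hNpos.le _
    calc g N * Chebyshev.psi (N : ℝ) ≤ g N * (c * N) := mul_le_mul_of_nonneg_left hψN hgN
      _ = c * (N : ℝ) ^ (1 - σ) := by
          rw [hg, show (1 : ℝ) - σ = -σ + 1 by ring, Real.rpow_add_one hNpos.ne']; ring
  -- the integral
  have hT3 : ‖∫ t in Set.Ioc ((1 : ℕ) : ℝ) N, deriv g t * Chebyshev.psi (⌊t⌋₊ : ℕ)‖ ≤
      σ * c * (N : ℝ) ^ (1 - σ) / (1 - σ) := by
    set bound : ℝ → ℝ := fun t ↦ σ * c * t ^ (-σ) with hbound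
    have hbcont : ContinuousOn bound (Set.Icc ((1 : ℕ) : ℝ) N) :=
      continuousOn_const.mul (continuousOn_id.rpow_const fun u hu ↦ Or.inl (by
        simp only [id, Nat.cast_one] at hu ⊢; linarith [hu.1]))
    have hbint : IntegrableOn bound (Set.Ioc ((1 : ℕ) : ℝ) N) :=
      (hbcont.integrableOn_Icc).mono_set Set.Ioc_subset_Icc_self
    have hle : ∀ᵐ t ∂(volume.restrict (Set.Ioc ((1 : ℕ) : ℝ) N)),
        ‖deriv g t * Chebyshev.psi (⌊t⌋₊ : ℕ)‖ ≤ bound t := by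
      rw [ae_restrict_iff' measurableSet_Ioc]
      refine Filter.Eventually.of_forall fun t ht ↦ ?_
      have ht0 : 0 < t := by simp only [Nat.cast_one] at ht; linarith [ht.1]
      have hfl : Chebyshev.psi ((⌊t⌋₊ : ℕ) : ℝ) ≤ c * t :=
        (Chebyshev.psi_le_const_mul_self (Nat.cast_nonneg _)).trans
          (mul_le_mul_of_nonneg_left (Nat.floor_le ht0.le) hc0.le)
      have hpow_pos := Real.rpow_pos_of_pos ht0 (-σ - 1)
      rw [hg_deriv t ht0, norm_mul, Real.norm_eq_abs, Real.norm_eq_abs,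
        abs_of_nonneg (Chebyshev.psi_nonneg _), abs_of_nonpos (by nlinarith), hbound]
      have hpow : t ^ (-σ - 1) * t = t ^ (-σ) := by
        rw [← Real.rpow_add_one ht0.ne']
        congr 1
        ring
      calc -(-σ * t ^ (-σ - 1)) * Chebyshev.psi ((⌊t⌋₊ : ℕ) : ℝ)
          ≤ -(-σ * t ^ (-σ - 1)) * (c * t) := mul_le_mul_of_nonneg_left hfl (by nlinarith)
        _ = σ * c * (t ^ (-σ - 1) * t) := by ring
        _ = σ * c * t ^ (-σ) := by rw [hpow]
    have hI := norm_integral_le_of_norm_le hbint hle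
    have h1N : ((1 : ℕ) : ℝ) ≤ N := by simpa using hNr
    have hprim : ∀ t ∈ Set.uIcc ((1 : ℕ) : ℝ) N,
        HasDerivAt (fun t : ℝ ↦ σ * c * (t ^ (1 - σ) / (1 - σ))) (bound t) t := by
      intro t ht
      rw [Set.uIcc_of_le h1N] at ht
      have ht0 : 0 < t := by simp only [Nat.cast_one] at ht; linarith [ht.1]
      have h1 := Real.hasDerivAt_rpow_const (p := 1 - σ) (Or.inl ht0.ne')
      have h2 := (h1.div_const (1 - σ)).const_mul (σ * c)
      refine h2.congr_deriv ?_
      rw [hbound]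
      simp only
      rw [show (1 : ℝ) - σ - 1 = -σ by ring]
      field_simp [h1σ.ne']
    have hval : ∫ t in Set.Ioc ((1 : ℕ) : ℝ) N, bound t =
        σ * c * ((N : ℝ) ^ (1 - σ) / (1 - σ)) - σ * c * (((1 : ℕ) : ℝ) ^ (1 - σ) / (1 - σ)) := by
      rw [← intervalIntegral.integral_of_le h1N,
        intervalIntegral.integral_eq_sub_of_hasDerivAt hprim
          ((hbcont.mono (by rw [Set.uIcc_of_le h1N])).intervalIntegrable)]
    have h1pow : ((1 : ℕ) : ℝ) ^ (1 - σ) = 1 := by rw [Nat.cast_one, Real.one_rpow]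
    rw [hval, h1pow] at hI
    have hsub : 0 ≤ σ * c * (1 / (1 - σ)) := by positivity
    calc ‖∫ t in Set.Ioc ((1 : ℕ) : ℝ) N, deriv g t * Chebyshev.psi (⌊t⌋₊ : ℕ)‖
        ≤ σ * c * ((N : ℝ) ^ (1 - σ) / (1 - σ)) - σ * c * (1 / (1 - σ)) := hI
      _ ≤ σ * c * ((N : ℝ) ^ (1 - σ) / (1 - σ)) := by linarith
      _ = σ * c * (N : ℝ) ^ (1 - σ) / (1 - σ) := by ring
  -- assemble
  have hNpow : 0 ≤ (N : ℝ) ^ (1 - σ) := Real.rpow_nonneg hNpos.le _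
  have hfin : g N * Chebyshev.psi (N : ℝ) - g ((1 : ℕ) : ℝ) * Chebyshev.psi ((1 : ℕ) : ℝ) -
      ∫ t in Set.Ioc ((1 : ℕ) : ℝ) N, deriv g t * Chebyshev.psi (⌊t⌋₊ : ℕ) ≤
      c * (N : ℝ) ^ (1 - σ) + σ * c * (N : ℝ) ^ (1 - σ) / (1 - σ) := by
    have := neg_le_abs (∫ t in Set.Ioc ((1 : ℕ) : ℝ) N, deriv g t * Chebyshev.psi (⌊t⌋₊ : ℕ))
    rw [← Real.norm_eq_abs] at this
    rw [hψ1, mul_zero, sub_zero, sub_eq_add_neg]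
    exact add_le_add hT1 (this.trans hT3)
  refine hfin.trans (le_of_eq ?_)
  field_simp
  ring

/-- `Σ_{n < N} Λ(n) n^{−σ} ≤ (log 4 + 4) N^{1−σ}/(1 − σ)` for `0 < σ < 1` (the terms `n = 0, 1` vanish).
[folklore] -/
private theorem sum_range_vonMangoldt_mul_rpow_le {σ : ℝ} (hσ0 : 0 < σ) (hσ1 : σ < 1) (N : ℕ) :
    ∑ n ∈ Finset.range N, (ArithmeticFunction.vonMangoldt n : ℝ) * (n : ℝ) ^ (-σ) ≤
      (Real.log 4 + 4) * (N : ℝ) ^ (1 - σ) / (1 - σ) := by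
  rcases Nat.eq_zero_or_pos N with rfl | hN
  · simp [Real.zero_rpow (show (1 : ℝ) - σ ≠ 0 by linarith)]
  have hsub : ∑ n ∈ Finset.range N, (ArithmeticFunction.vonMangoldt n : ℝ) * (n : ℝ) ^ (-σ) =
      ∑ n ∈ (Finset.range N).filter (fun n ↦ 1 < n),
        (ArithmeticFunction.vonMangoldt n : ℝ) * (n : ℝ) ^ (-σ) := by
    rw [Finset.sum_filter_of_ne]
    intro n _ hne
    by_contra hn
    push Not at hn
    interval_cases n
    · simp at hne
    · simp [ArithmeticFunction.vonMangoldt_apply_one] at hne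
  rw [hsub]
  calc ∑ n ∈ (Finset.range N).filter (fun n ↦ 1 < n),
        (ArithmeticFunction.vonMangoldt n : ℝ) * (n : ℝ) ^ (-σ)
      ≤ ∑ n ∈ Finset.Ioc 1 N, (ArithmeticFunction.vonMangoldt n : ℝ) * (n : ℝ) ^ (-σ) := by
        refine Finset.sum_le_sum_of_subset_of_nonneg (fun n hn ↦ ?_) fun n _ _ ↦
          mul_nonneg ArithmeticFunction.vonMangoldt_nonneg (Real.rpow_nonneg (Nat.cast_nonneg _) _)
        simp only [Finset.mem_filter, Finset.mem_range] at hn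
        simp only [Finset.mem_Ioc]
        omega
    _ ≤ _ := sum_Ioc_vonMangoldt_mul_rpow_le hσ0 hσ1 hN

/-! ## B. The two-scale kernel: crude bound and linearity -/

/-- A crude bound for the kernel: `‖−2e^{−az}(1−e^{−bz})²/z³‖ ≤ 2e^{−a Re z}(1 + e^{−b Re z})²/‖z‖³`
(`z ≠ 0`). [folklore] -/
private theorem norm_kernel_le {a b : ℝ} {z : ℂ} (hz : z ≠ 0) :
    ‖-2 * Complex.exp (-(z * a)) * (1 - Complex.exp (-(z * b))) ^ 2 / z ^ 3‖ ≤
      2 * Real.exp (-(a * z.re)) * (1 + Real.exp (-(b * z.re))) ^ 2 / ‖z‖ ^ 3 := by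
  have hexp : ‖Complex.exp (-(z * a))‖ = Real.exp (-(a * z.re)) := by
    rw [Complex.norm_exp]; congr 1; simp [Complex.mul_re]; ring
  have hexpb : ‖Complex.exp (-(z * b))‖ = Real.exp (-(b * z.re)) := by
    rw [Complex.norm_exp]; congr 1; simp [Complex.mul_re]; ring
  have h1 : ‖(1 : ℂ) - Complex.exp (-(z * b))‖ ≤ 1 + Real.exp (-(b * z.re)) := by
    refine (norm_sub_le _ _).trans ?_
    rw [norm_one, hexpb]
  have hz3 : 0 < ‖z‖ ^ 3 := pow_pos (norm_pos_iff.2 hz) 3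
  rw [norm_div, norm_mul, norm_mul, norm_neg, norm_pow, norm_pow, Complex.norm_ofNat, hexp]
  refine div_le_div_of_nonneg_right ?_ hz3.le
  have h0 : 0 ≤ ‖(1 : ℂ) - Complex.exp (-(z * b))‖ := norm_nonneg _
  have := mul_le_mul h1 h1 h0 (by positivity)
  have he0 : 0 ≤ 2 * Real.exp (-(a * z.re)) := by positivity
  nlinarith

/-- `g_a − 2g_{a+b} + g_{a+2b} = 2b² f_b(· − a + b)`: the two-scale smoothing is Selberg's `f_b`
translated to have its plateau of length `a`. [folklore] -/
private theorem comb_quadPiece_eq (a b u : ℝ) :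
    quadPiece a u - 2 * quadPiece (a + b) u + quadPiece (a + 2 * b) u =
      quadPiece b (u - a + b) - 2 * quadPiece (2 * b) (u - a + b) + quadPiece (3 * b) (u - a + b) := by
  have e1 : quadPiece b (u - a + b) = quadPiece a u := by
    simp only [quadPiece]; rw [show b - (u - a + b) = a - u by ring]
  have e2 : quadPiece (2 * b) (u - a + b) = quadPiece (a + b) u := by
    simp only [quadPiece]; rw [show 2 * b - (u - a + b) = a + b - u by ring]
  have e3 : quadPiece (3 * b) (u - a + b) = quadPiece (a + 2 * b) u := by
    simp only [quadPiece]; rw [show 3 * b - (u - a + b) = a + 2 * b - u by ring]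
  rw [e1, e2, e3]

/-- `|g_a − 2g_{a+b} + g_{a+2b}| ≤ 2b²` (`b > 0`), from `0 ≤ f_b ≤ 1`. [folklore] -/
private theorem abs_comb_quadPiece_le {a b : ℝ} (hb : 0 < b) (u : ℝ) :
    |quadPiece a u - 2 * quadPiece (a + b) u + quadPiece (a + 2 * b) u| ≤ 2 * b ^ 2 := by
  rw [comb_quadPiece_eq]
  have h0 := smoothing_nonneg hb (u - a + b)
  have h1 := smoothing_le_one hb (u - a + b)
  have hb2 : 0 < 2 * b ^ 2 := by positivity
  have e : quadPiece b (u - a + b) - 2 * quadPiece (2 * b) (u - a + b) + quadPiece (3 * b) (u - a + b) =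
      2 * b ^ 2 * smoothing b (u - a + b) := by
    rw [smoothing]; field_simp
  rw [e, abs_le]
  constructor <;> nlinarith


/-- **Linearity of `F₀` on the two-scale combination**: the transform of
`u ↦ g_a(u) − 2g_{a+b}(u) + g_{a+2b}(u)` is `F₀^{(a)} − 2F₀^{(a+b)} + F₀^{(a+2b)}` at every `z`
(all four are integrals of continuous functions over `[0, a+2b]`). [folklore] -/
private theorem fordLaplace₀_twoScale {a b : ℝ} (ha : 0 ≤ a) (hb : 0 ≤ b) (z : ℂ) :
    fordLaplace₀ (fun u ↦ quadPiece a u - 2 * quadPiece (a + b) u + quadPiece (a + 2 * b) u) z =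
      fordLaplace₀ (quadPiece a) z - 2 * fordLaplace₀ (quadPiece (a + b)) z +
        fordLaplace₀ (quadPiece (a + 2 * b)) z := by
  have hx : 0 ≤ a + 2 * b := by linarith
  have e0 : ∀ c, c ≤ a + 2 * b → fordLaplace (quadPiece c) z =
      ∫ t in (0:ℝ)..(a + 2 * b), (quadPiece c t : ℂ) * Complex.exp (-(z * t)) := fun c hc ↦
    fordLaplace_eq_intervalIntegral (f := quadPiece c) (p := quadPiece c) hx (fun _ _ ↦ rfl)
      (fun u hu ↦ quadPiece_of_ge (hc.trans hu)) (continuous_quadPiece c) z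
  have hcont : Continuous fun u ↦ quadPiece a u - 2 * quadPiece (a + b) u + quadPiece (a + 2 * b) u := by
    have := continuous_quadPiece a
    have := continuous_quadPiece (a + b)
    have := continuous_quadPiece (a + 2 * b)
    fun_prop
  have ec : fordLaplace (fun u ↦ quadPiece a u - 2 * quadPiece (a + b) u + quadPiece (a + 2 * b) u) z =
      ∫ t in (0:ℝ)..(a + 2 * b),
        ((quadPiece a t - 2 * quadPiece (a + b) t + quadPiece (a + 2 * b) t : ℝ) : ℂ) *
          Complex.exp (-(z * t)) :=
    fordLaplace_eq_intervalIntegral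
      (p := fun u ↦ quadPiece a u - 2 * quadPiece (a + b) u + quadPiece (a + 2 * b) u) hx
      (fun _ _ ↦ rfl)
      (fun u hu ↦ by
        simp only [quadPiece_of_ge (le_trans (by linarith : a ≤ a + 2 * b) hu),
          quadPiece_of_ge (le_trans (by linarith : a + b ≤ a + 2 * b) hu), quadPiece_of_ge hu]
        ring)
      hcont z
  have hi : ∀ c, IntervalIntegrable (fun t : ℝ ↦ (quadPiece c t : ℂ) * Complex.exp (-(z * t)))
      volume 0 (a + 2 * b) := fun c ↦ by
    apply Continuous.intervalIntegrable
    have := continuous_quadPiece c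
    fun_prop
  have hsplit : (∫ t in (0:ℝ)..(a + 2 * b),
        ((quadPiece a t - 2 * quadPiece (a + b) t + quadPiece (a + 2 * b) t : ℝ) : ℂ) *
          Complex.exp (-(z * t))) =
      (∫ t in (0:ℝ)..(a + 2 * b), (quadPiece a t : ℂ) * Complex.exp (-(z * t))) -
        2 * (∫ t in (0:ℝ)..(a + 2 * b), (quadPiece (a + b) t : ℂ) * Complex.exp (-(z * t))) +
        ∫ t in (0:ℝ)..(a + 2 * b), (quadPiece (a + 2 * b) t : ℂ) * Complex.exp (-(z * t)) := by
    have e : (fun t : ℝ ↦ ((quadPiece a t - 2 * quadPiece (a + b) t + quadPiece (a + 2 * b) t : ℝ) : ℂ) *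
          Complex.exp (-(z * t))) =
        fun t ↦ ((quadPiece a t : ℂ) * Complex.exp (-(z * t)) -
          2 * ((quadPiece (a + b) t : ℂ) * Complex.exp (-(z * t)))) +
          (quadPiece (a + 2 * b) t : ℂ) * Complex.exp (-(z * t)) := by
      funext t; push_cast; ring
    rw [e, intervalIntegral.integral_add ((hi a).sub (((hi (a + b)).const_mul 2))) (hi _),
      intervalIntegral.integral_sub (hi a) ((hi (a + b)).const_mul 2),
      intervalIntegral.integral_const_mul]
  simp only [fordLaplace₀]
  rw [ec, e0 a (by linarith), e0 (a + b) (by linarith), e0 (a + 2 * b) le_rfl, hsplit,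
    quadPiece_zero a ha, quadPiece_zero (a + b) (by linarith), quadPiece_zero (a + 2 * b) hx]
  push_cast
  ring

/-- To the right of the imaginary axis (`Re z > 0`, `b ≥ 0`):
`‖kernel(z)‖ ≤ (8e^{−a Re z}/Re z)/((Re z)² + (Im z)²)`, from `‖z‖³ ≥ Re z · ‖z‖²`. [folklore] -/
private theorem norm_kernel_le_right {a b : ℝ} (hb : 0 ≤ b) {z : ℂ} (hz : 0 < z.re) :
    ‖-2 * Complex.exp (-(z * a)) * (1 - Complex.exp (-(z * b))) ^ 2 / z ^ 3‖ ≤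
      8 * Real.exp (-(a * z.re)) / z.re / (z.re ^ 2 + z.im ^ 2) := by
  have hz0 : z ≠ 0 := fun h ↦ by rw [h, Complex.zero_re] at hz; exact lt_irrefl _ hz
  refine (norm_kernel_le hz0).trans ?_
  have hn2 : ‖z‖ ^ 2 = z.re ^ 2 + z.im ^ 2 := by rw [Complex.sq_norm, Complex.normSq_apply]; ring
  have hnz : z.re ≤ ‖z‖ := Complex.re_le_norm z
  have hn0 : 0 ≤ ‖z‖ := norm_nonneg z
  have hz3 : z.re * (z.re ^ 2 + z.im ^ 2) ≤ ‖z‖ ^ 3 := by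
    rw [← hn2]
    calc z.re * ‖z‖ ^ 2 ≤ ‖z‖ * ‖z‖ ^ 2 := mul_le_mul_of_nonneg_right hnz (by positivity)
      _ = ‖z‖ ^ 3 := by ring
  have heb : (1 + Real.exp (-(b * z.re))) ^ 2 ≤ 4 := by
    have : Real.exp (-(b * z.re)) ≤ 1 := by
      rw [Real.exp_le_one_iff]; nlinarith
    nlinarith [Real.exp_pos (-(b * z.re))]
  have hpos : 0 < z.re * (z.re ^ 2 + z.im ^ 2) := by positivity
  have hz3pos : 0 < ‖z‖ ^ 3 := pow_pos (norm_pos_iff.2 hz0) 3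
  have hE := Real.exp_pos (-(a * z.re))
  calc 2 * Real.exp (-(a * z.re)) * (1 + Real.exp (-(b * z.re))) ^ 2 / ‖z‖ ^ 3
      ≤ 8 * Real.exp (-(a * z.re)) / ‖z‖ ^ 3 := by
        refine div_le_div_of_nonneg_right ?_ hz3pos.le
        nlinarith
    _ ≤ 8 * Real.exp (-(a * z.re)) / (z.re * (z.re ^ 2 + z.im ^ 2)) :=
        div_le_div_of_nonneg_left (by positivity) hpos hz3
    _ = 8 * Real.exp (-(a * z.re)) / z.re / (z.re ^ 2 + z.im ^ 2) := by rw [div_div]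

/-! ## C. Zeros of `L(s, χ)` in unit windows: `Σ_ρ m(ρ)/(1 + (γ − t)²) ≪ log q(|t|+4)` -/

/-- **Shifted window sum**: there is an absolute `C > 0` such that for every primitive `χ` mod `q > 1`
and every real `t`, the sum `Σ_ρ m(ρ)/(1 + (γ − t)²)` over the non-trivial zeros of `L(s, χ)`
(multiplicity `m = zeroOrder χ`) converges and is `≤ C (log q + log(|t| + 4))` — from the unit-window
count `N(τ + ½, χ) − N(τ − ½, χ) ≪ log q(|τ| + 4)` (`ExplicitPsiChar.exists_sum_window_le`) summed against
`1/(1 + k²)`. [cite: MontgomeryVaughan2007, Theorem 10.17] -/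
theorem exists_tsum_zeroOrder_div_shift_le :
    ∃ C : ℝ, 0 < C ∧ ∀ (q : ℕ) [NeZero q] (χ : DirichletCharacter ℂ q), χ.IsPrimitive → 1 < q →
      ∀ t : ℝ, Summable (fun ρ : charNontrivialZeros χ ↦
          (DirichletDisc.zeroOrder χ (ρ : ℂ) : ℝ) / (1 + ((ρ : ℂ).im - t) ^ 2)) ∧
        ∑' ρ : charNontrivialZeros χ,
            (DirichletDisc.zeroOrder χ (ρ : ℂ) : ℝ) / (1 + ((ρ : ℂ).im - t) ^ 2) ≤
          C * (Real.log q + Real.log (|t| + 4)) := by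
  classical
  obtain ⟨C, hC0, hC⟩ := ExplicitPsiChar.exists_sum_window_le
  have hw := ExplicitPsiChar.summable_window_weight (A := 1) zero_le_one
  set W : ℝ := ∑' k : ℤ, (1 + Real.log (|(k : ℝ)| + 4)) / (1 + (k : ℝ) ^ 2) with hW
  have hW0 : 0 ≤ W := tsum_nonneg fun k ↦ by
    have : 0 ≤ Real.log (|(k : ℝ)| + 4) := Real.log_nonneg (by linarith [abs_nonneg (k : ℝ)])
    positivity
  refine ⟨4 * C * W + 1, by positivity, fun q _ χ hprim hq t ↦ ?_⟩
  have hq0 : 0 ≤ Real.log q := Real.log_natCast_nonneg q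
  have hlt4 : 1 ≤ Real.log (|t| + 4) := by
    rw [Real.le_log_iff_exp_le (by positivity)]
    linarith [abs_nonneg t, lt_trans Real.exp_one_lt_d9 (by norm_num : (2.7182818286 : ℝ) < 4)]
  set Lq : ℝ := Real.log q + Real.log (|t| + 4) with hLq
  have hLq1 : 1 ≤ Lq := by rw [hLq]; linarith
  set g : ℤ → ℝ := fun k ↦ 4 * C * Lq * ((1 + Real.log (|(k : ℝ)| + 4)) / (1 + (k : ℝ) ^ 2)) with hg
  have hgsum : Summable g := hw.mul_left (4 * C * Lq)
  have hg0 : ∀ k, 0 ≤ g k := fun k ↦ by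
    have : 0 ≤ Real.log (|(k : ℝ)| + 4) := Real.log_nonneg (by linarith [abs_nonneg (k : ℝ)])
    positivity
  have hgt : ∑' k, g k = 4 * C * Lq * W := by rw [hg, tsum_mul_left]
  -- every finite partial sum is `≤ Σ_k g k`
  have key : ∀ u : Finset (charNontrivialZeros χ),
      ∑ ρ ∈ u, (DirichletDisc.zeroOrder χ (ρ : ℂ) : ℝ) / (1 + ((ρ : ℂ).im - t) ^ 2) ≤ ∑' k, g k := by
    intro u
    set kf : charNontrivialZeros χ → ℤ := fun ρ ↦ round ((ρ : ℂ).im - t) with hkf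
    rw [← Finset.sum_fiberwise_of_maps_to (g := kf) (fun ρ _ ↦ Finset.mem_image_of_mem kf ‹_›)]
    refine (Finset.sum_le_sum fun k hk ↦ ?_).trans (hgsum.sum_le_tsum _ (fun k _ ↦ hg0 k))
    have hfib : ∀ ρ ∈ u.filter (fun ρ ↦ kf ρ = k), |(ρ : ℂ).im - (t + k)| ≤ 1 / 2 := by
      intro ρ hρ
      have h := (Finset.mem_filter.1 hρ).2
      rw [← h]
      have := abs_sub_round ((ρ : ℂ).im - t)
      rwa [show (ρ : ℂ).im - (t + ((kf ρ : ℤ) : ℝ)) = (ρ : ℂ).im - t - round ((ρ : ℂ).im - t) by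
        rw [hkf]; ring]
    have hwin := hC q χ hprim hq (t + k) ((u.filter (fun ρ ↦ kf ρ = k)).image Subtype.val) (by
      intro z hz
      obtain ⟨ρ, hρ, rfl⟩ := Finset.mem_image.1 hz
      exact ⟨ρ.2.1, ρ.2.2.1, ρ.2.2.2, hfib ρ hρ⟩)
    rw [Finset.sum_image (fun a _ b _ h ↦ Subtype.ext h)] at hwin
    have hlogk : Real.log (|t + k| + 4) ≤ Real.log (|t| + 4) + Real.log (|(k : ℝ)| + 4) := by
      rw [← Real.log_mul (by positivity) (by positivity)]
      refine Real.log_le_log (by positivity) ?_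
      nlinarith [abs_add_le t (k : ℝ), abs_nonneg t, abs_nonneg (k : ℝ),
        mul_nonneg (abs_nonneg t) (abs_nonneg (k : ℝ))]
    have hbound : ∀ ρ ∈ u.filter (fun ρ ↦ kf ρ = k),
        (DirichletDisc.zeroOrder χ (ρ : ℂ) : ℝ) / (1 + ((ρ : ℂ).im - t) ^ 2) ≤
          (4 / (1 + (k : ℝ) ^ 2)) * (DirichletDisc.zeroOrder χ (ρ : ℂ) : ℝ) := by
      intro ρ hρ
      have h1 := hfib ρ hρ
      set γ' : ℝ := (ρ : ℂ).im - t with hγ'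
      have h1' : |γ' - k| ≤ 1 / 2 := by rwa [hγ', show (ρ : ℂ).im - t - k = (ρ : ℂ).im - (t + k) by ring]
      have hden : 1 + (k : ℝ) ^ 2 ≤ 4 * (1 + γ' ^ 2) := by
        have h2 : |(k : ℝ)| ≤ |γ'| + 1 / 2 := by
          calc |(k : ℝ)| = |γ' - (γ' - k)| := by congr 1; ring
            _ ≤ |γ'| + |γ' - k| := abs_sub _ _
            _ ≤ |γ'| + 1 / 2 := by linarith
        have h3 : (k : ℝ) ^ 2 ≤ (|γ'| + 1 / 2) ^ 2 := by
          rw [← sq_abs (k : ℝ)]; exact pow_le_pow_left₀ (abs_nonneg _) h2 2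
        nlinarith [sq_nonneg (|γ'| - 1 / 2), sq_abs γ', abs_nonneg γ']
      rw [div_le_iff₀ (by positivity), mul_comm, ← mul_assoc]
      refine le_mul_of_one_le_left (Nat.cast_nonneg _) ?_
      rw [mul_div_assoc', one_le_div (by positivity)]
      linarith
    calc ∑ ρ ∈ u.filter (fun ρ ↦ kf ρ = k),
          (DirichletDisc.zeroOrder χ (ρ : ℂ) : ℝ) / (1 + ((ρ : ℂ).im - t) ^ 2)
        ≤ ∑ ρ ∈ u.filter (fun ρ ↦ kf ρ = k),
            (4 / (1 + (k : ℝ) ^ 2)) * (DirichletDisc.zeroOrder χ (ρ : ℂ) : ℝ) := Finset.sum_le_sum hbound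
      _ = (4 / (1 + (k : ℝ) ^ 2)) *
            ∑ ρ ∈ u.filter (fun ρ ↦ kf ρ = k), (DirichletDisc.zeroOrder χ (ρ : ℂ) : ℝ) := by
          rw [Finset.mul_sum]
      _ ≤ (4 / (1 + (k : ℝ) ^ 2)) * (C * (Real.log q + Real.log (|t + k| + 4))) :=
          mul_le_mul_of_nonneg_left hwin (by positivity)
      _ ≤ (4 / (1 + (k : ℝ) ^ 2)) * (C * (Lq * (1 + Real.log (|(k : ℝ)| + 4)))) := by
          have hlk : 0 ≤ Real.log (|(k : ℝ)| + 4) := Real.log_nonneg (by linarith [abs_nonneg (k : ℝ)])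
          gcongr
          rw [hLq]
          nlinarith
      _ = g k := by rw [hg]; ring
  have hnn : ∀ ρ : charNontrivialZeros χ,
      0 ≤ (DirichletDisc.zeroOrder χ (ρ : ℂ) : ℝ) / (1 + ((ρ : ℂ).im - t) ^ 2) := fun ρ ↦ by positivity
  have hsumm : Summable (fun ρ : charNontrivialZeros χ ↦
      (DirichletDisc.zeroOrder χ (ρ : ℂ) : ℝ) / (1 + ((ρ : ℂ).im - t) ^ 2)) :=
    summable_of_sum_le hnn key
  refine ⟨hsumm, ?_⟩
  calc ∑' ρ : charNontrivialZeros χ, (DirichletDisc.zeroOrder χ (ρ : ℂ) : ℝ) / (1 + ((ρ : ℂ).im - t) ^ 2)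
      ≤ ∑' k, g k := Real.tsum_le_of_sum_le hnn key
    _ = 4 * C * Lq * W := hgt
    _ ≤ (4 * C * W + 1) * Lq := by nlinarith [mul_nonneg (mul_nonneg (by positivity : (0:ℝ) ≤ 4 * C) hW0) (by linarith : (0:ℝ) ≤ Lq)]
    _ = (4 * C * W + 1) * (Real.log q + Real.log (|t| + 4)) := by rw [hLq]

/-! ## D. The two-scale explicit formula for `L′/L` and the bounds of its terms -/

section Char

variable {q : ℕ} [NeZero q] {χ : DirichletCharacter ℂ q}

/-- **The two-scale explicit formula for `L′/L(s, χ)`** (`χ` primitive mod `q > 1`, `a, b ≥ 0`,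
`−1/2 < Re s < 3/2`, `L(s, χ) ≠ 0`):
`2b² L′/L(s,χ) = −(K_a − 2K_{a+b} + K_{a+2b}) − Σ_ρ m(ρ) kernel(s−ρ) − Σ_τ m(τ) kernel(s−τ) + (J_a − 2J_{a+b} + J_{a+2b})`,
three instances of Heath-Brown's exact formula `ExplicitPsiChar.charFordK_eq_explicit`.
[cite: HeathBrown1992PLMS, Lemma 5.1] [cite: MontgomeryVaughan2007, §13.2, (13.35)] -/
theorem explicit_formula_twoScale (hprim : χ.IsPrimitive) (hq : 1 < q) {a b : ℝ} (ha : 0 ≤ a)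
    (hb : 0 ≤ b) {s : ℂ} (hσ₁ : -(1 / 2) < s.re) (hσ₂ : s.re < 3 / 2) (hLs : χ.LFunction s ≠ 0) :
    2 * (b : ℂ) ^ 2 * (deriv χ.LFunction s / χ.LFunction s) =
      -(charFordK χ (quadPiece a) s - 2 * charFordK χ (quadPiece (a + b)) s +
          charFordK χ (quadPiece (a + 2 * b)) s) -
      (∑' ρ : charNontrivialZeros χ, (DirichletDisc.zeroOrder χ (ρ : ℂ) : ℂ) *
        (fordLaplace₀ (quadPiece a) (s - ρ) - 2 * fordLaplace₀ (quadPiece (a + b)) (s - ρ) +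
          fordLaplace₀ (quadPiece (a + 2 * b)) (s - ρ))) -
      (∑ τ ∈ charTrivialZeroFinset (ne_one_of_isPrimitive hprim hq), (DirichletDisc.zeroOrder χ τ : ℂ) *
        (fordLaplace₀ (quadPiece a) (s - τ) - 2 * fordLaplace₀ (quadPiece (a + b)) (s - τ) +
          fordLaplace₀ (quadPiece (a + 2 * b)) (s - τ))) +
      (charEFRemainder χ (quadPiece a) s - 2 * charEFRemainder χ (quadPiece (a + b)) s +
        charEFRemainder χ (quadPiece (a + 2 * b)) s) := by
  have hT1 := isSmoothedEFTest_quadPiece ha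
  have hT2 := isSmoothedEFTest_quadPiece (a := a + b) (by linarith)
  have hT3 := isSmoothedEFTest_quadPiece (a := a + 2 * b) (by linarith)
  have h1 := charFordK_eq_explicit hprim hq hT1 hσ₁ hσ₂ hLs
  have h2 := charFordK_eq_explicit hprim hq hT2 hσ₁ hσ₂ hLs
  have h3 := charFordK_eq_explicit hprim hq hT3 hσ₁ hσ₂ hLs
  have hσ₁' : -1 < s.re := by linarith
  have hs1' := (summable_norm_charZeroTerm hprim hq hT1 hσ₁' hLs).of_norm
  have hs2' := (summable_norm_charZeroTerm hprim hq hT2 hσ₁' hLs).of_norm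
  have hs3' := (summable_norm_charZeroTerm hprim hq hT3 hσ₁' hLs).of_norm
  set S1 := ∑' ρ : charNontrivialZeros χ,
    (DirichletDisc.zeroOrder χ (ρ : ℂ) : ℂ) * fordLaplace₀ (quadPiece a) (s - ρ) with hS1
  set S2 := ∑' ρ : charNontrivialZeros χ,
    (DirichletDisc.zeroOrder χ (ρ : ℂ) : ℂ) * fordLaplace₀ (quadPiece (a + b)) (s - ρ) with hS2
  set S3 := ∑' ρ : charNontrivialZeros χ,
    (DirichletDisc.zeroOrder χ (ρ : ℂ) : ℂ) * fordLaplace₀ (quadPiece (a + 2 * b)) (s - ρ) with hS3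
  have hS : ∑' ρ : charNontrivialZeros χ, (DirichletDisc.zeroOrder χ (ρ : ℂ) : ℂ) *
        (fordLaplace₀ (quadPiece a) (s - ρ) - 2 * fordLaplace₀ (quadPiece (a + b)) (s - ρ) +
          fordLaplace₀ (quadPiece (a + 2 * b)) (s - ρ)) = S1 - 2 * S2 + S3 := by
    have e : ∀ ρ : charNontrivialZeros χ, (DirichletDisc.zeroOrder χ (ρ : ℂ) : ℂ) *
        (fordLaplace₀ (quadPiece a) (s - ρ) - 2 * fordLaplace₀ (quadPiece (a + b)) (s - ρ) +
          fordLaplace₀ (quadPiece (a + 2 * b)) (s - ρ)) =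
        (DirichletDisc.zeroOrder χ (ρ : ℂ) : ℂ) * fordLaplace₀ (quadPiece a) (s - ρ) -
          2 * ((DirichletDisc.zeroOrder χ (ρ : ℂ) : ℂ) * fordLaplace₀ (quadPiece (a + b)) (s - ρ)) +
          (DirichletDisc.zeroOrder χ (ρ : ℂ) : ℂ) * fordLaplace₀ (quadPiece (a + 2 * b)) (s - ρ) :=
      fun ρ ↦ by ring
    simp_rw [e]
    rw [(hs1'.sub (hs2'.mul_left 2)).tsum_add hs3', hs1'.tsum_sub (hs2'.mul_left 2), tsum_mul_left]
  rw [hS]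
  have hT : ∑ τ ∈ charTrivialZeroFinset (ne_one_of_isPrimitive hprim hq), (DirichletDisc.zeroOrder χ τ : ℂ) *
        (fordLaplace₀ (quadPiece a) (s - τ) - 2 * fordLaplace₀ (quadPiece (a + b)) (s - τ) +
          fordLaplace₀ (quadPiece (a + 2 * b)) (s - τ)) =
      (∑ τ ∈ charTrivialZeroFinset (ne_one_of_isPrimitive hprim hq),
          (DirichletDisc.zeroOrder χ τ : ℂ) * fordLaplace₀ (quadPiece a) (s - τ)) -
        2 * (∑ τ ∈ charTrivialZeroFinset (ne_one_of_isPrimitive hprim hq),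
          (DirichletDisc.zeroOrder χ τ : ℂ) * fordLaplace₀ (quadPiece (a + b)) (s - τ)) +
        ∑ τ ∈ charTrivialZeroFinset (ne_one_of_isPrimitive hprim hq),
          (DirichletDisc.zeroOrder χ τ : ℂ) * fordLaplace₀ (quadPiece (a + 2 * b)) (s - τ) := by
    rw [Finset.mul_sum, ← Finset.sum_sub_distrib, ← Finset.sum_add_distrib]
    exact Finset.sum_congr rfl fun τ _ ↦ by ring
  rw [hT]
  have hg : ((quadPiece a 0 : ℝ) : ℂ) - 2 * ((quadPiece (a + b) 0 : ℝ) : ℂ) +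
      ((quadPiece (a + 2 * b) 0 : ℝ) : ℂ) = 2 * (b : ℂ) ^ 2 := by
    rw [quadPiece_zero _ ha, quadPiece_zero _ (by linarith), quadPiece_zero _ (by linarith)]
    push_cast; ring
  linear_combination h1 - 2 * h2 + h3 - (deriv χ.LFunction s / χ.LFunction s) * hg

omit [NeZero q] in
/-- **The Dirichlet-polynomial side**: `‖K_a − 2K_{a+b} + K_{a+2b}‖ ≤ 2b² Σ_{n < N} Λ(n) n^{−Re s}` for `N ≥ 1`
with `a + 2b ≤ log N` (`b > 0`; `|χ(n)| ≤ 1`, `|g_a − 2g_{a+b} + g_{a+2b}| ≤ 2b²`).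
[cite: MontgomeryVaughan2007, Thm 13.13 (proof)] -/
theorem norm_comb_charFordK_le (χ : DirichletCharacter ℂ q) {a b : ℝ} (hb : 0 < b) (s : ℂ) {N : ℕ}
    (hN : 1 ≤ N) (hx : a + 2 * b ≤ Real.log N) :
    ‖charFordK χ (quadPiece a) s - 2 * charFordK χ (quadPiece (a + b)) s +
        charFordK χ (quadPiece (a + 2 * b)) s‖ ≤
      2 * b ^ 2 * ∑ n ∈ Finset.range N, (ArithmeticFunction.vonMangoldt n : ℝ) * (n : ℝ) ^ (-s.re) := by
  rw [charFordK_eq_sum χ (f := quadPiece a) (x₀ := a) (fun _ hu ↦ quadPiece_of_ge hu) hN (by linarith) s,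
    charFordK_eq_sum χ (f := quadPiece (a + b)) (x₀ := a + b) (fun _ hu ↦ quadPiece_of_ge hu) hN
      (by linarith) s,
    charFordK_eq_sum χ (f := quadPiece (a + 2 * b)) (x₀ := a + 2 * b) (fun _ hu ↦ quadPiece_of_ge hu)
      hN hx s]
  have hcomb : (∑ n ∈ Finset.range N, ((ArithmeticFunction.vonMangoldt n : ℝ) : ℂ) * χ n *
        (quadPiece a (Real.log n) : ℂ) * (n : ℂ) ^ (-s)) -
      2 * (∑ n ∈ Finset.range N, ((ArithmeticFunction.vonMangoldt n : ℝ) : ℂ) * χ n *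
        (quadPiece (a + b) (Real.log n) : ℂ) * (n : ℂ) ^ (-s)) +
      (∑ n ∈ Finset.range N, ((ArithmeticFunction.vonMangoldt n : ℝ) : ℂ) * χ n *
        (quadPiece (a + 2 * b) (Real.log n) : ℂ) * (n : ℂ) ^ (-s)) =
      ∑ n ∈ Finset.range N, ((ArithmeticFunction.vonMangoldt n : ℝ) : ℂ) * χ n *
        ((quadPiece a (Real.log n) - 2 * quadPiece (a + b) (Real.log n) +
          quadPiece (a + 2 * b) (Real.log n) : ℝ) : ℂ) * (n : ℂ) ^ (-s) := by
    rw [Finset.mul_sum, ← Finset.sum_sub_distrib, ← Finset.sum_add_distrib]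
    refine Finset.sum_congr rfl fun n _ ↦ ?_
    push_cast; ring
  rw [hcomb, Finset.mul_sum]
  refine (norm_sum_le _ _).trans (Finset.sum_le_sum fun n _ ↦ ?_)
  rcases Nat.eq_zero_or_pos n with rfl | hn
  · simp
  have hn' : (0 : ℝ) < n := by exact_mod_cast hn
  have hΛ : 0 ≤ (ArithmeticFunction.vonMangoldt n : ℝ) := ArithmeticFunction.vonMangoldt_nonneg
  have hχn : ‖χ n‖ ≤ 1 := DirichletCharacter.norm_le_one χ _
  rw [norm_mul, norm_mul, norm_mul, Complex.norm_real, Real.norm_eq_abs, abs_of_nonneg hΛ,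
    Complex.norm_real, Real.norm_eq_abs, Complex.norm_natCast_cpow_of_pos hn, Complex.neg_re]
  have hw := abs_comb_quadPiece_le (a := a) hb (Real.log n)
  have hp : 0 ≤ (n : ℝ) ^ (-s.re) := Real.rpow_nonneg hn'.le _
  have h0 : 0 ≤ |quadPiece a (Real.log n) - 2 * quadPiece (a + b) (Real.log n) +
      quadPiece (a + 2 * b) (Real.log n)| := abs_nonneg _
  calc (ArithmeticFunction.vonMangoldt n : ℝ) * ‖χ n‖ *
        |quadPiece a (Real.log n) - 2 * quadPiece (a + b) (Real.log n) + quadPiece (a + 2 * b) (Real.log n)| *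
        (n : ℝ) ^ (-s.re)
      ≤ (ArithmeticFunction.vonMangoldt n : ℝ) * 1 * (2 * b ^ 2) * (n : ℝ) ^ (-s.re) := by
        gcongr
    _ = 2 * b ^ 2 * ((ArithmeticFunction.vonMangoldt n : ℝ) * (n : ℝ) ^ (-s.re)) := by ring

/-- **The sum over the zeros under GRH(χ)**: for `Re s = σ > ½` every non-trivial zero has
`Re(s − ρ) = σ − ½ =: d`, so `‖Σ_ρ m(ρ) kernel(s − ρ)‖ ≤ (8e^{−ad}/(d·min(d²,1))) Σ_ρ m(ρ)/(1 + (γ − Im s)²)`.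
[cite: MontgomeryVaughan2007, Thm 13.13 (proof: the sum over ρ)] -/
theorem norm_zeroSum_le (hG : χ.RiemannHypothesis) {a b : ℝ} (ha : 0 ≤ a) (hb : 0 ≤ b) {s : ℂ}
    (hs : 1 / 2 < s.re)
    (hsumm : Summable (fun ρ : charNontrivialZeros χ ↦
      (DirichletDisc.zeroOrder χ (ρ : ℂ) : ℝ) / (1 + ((ρ : ℂ).im - s.im) ^ 2))) :
    ‖∑' ρ : charNontrivialZeros χ, (DirichletDisc.zeroOrder χ (ρ : ℂ) : ℂ) *
        (fordLaplace₀ (quadPiece a) (s - ρ) - 2 * fordLaplace₀ (quadPiece (a + b)) (s - ρ) +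
          fordLaplace₀ (quadPiece (a + 2 * b)) (s - ρ))‖ ≤
      8 * Real.exp (-(a * (s.re - 1 / 2))) / ((s.re - 1 / 2) * min ((s.re - 1 / 2) ^ 2) 1) *
        ∑' ρ : charNontrivialZeros χ,
          (DirichletDisc.zeroOrder χ (ρ : ℂ) : ℝ) / (1 + ((ρ : ℂ).im - s.im) ^ 2) := by
  set d : ℝ := s.re - 1 / 2 with hd
  have hd0 : 0 < d := by rw [hd]; linarith
  set μ : ℝ := min (d ^ 2) 1 with hμ
  have hμ0 : 0 < μ := lt_min (by positivity) one_pos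
  set κ : ℝ := 8 * Real.exp (-(a * d)) / (d * μ) with hκ
  have hκ0 : 0 ≤ κ := by positivity
  -- pointwise bound
  have hpt : ∀ ρ : charNontrivialZeros χ,
      ‖(DirichletDisc.zeroOrder χ (ρ : ℂ) : ℂ) *
          (fordLaplace₀ (quadPiece a) (s - ρ) - 2 * fordLaplace₀ (quadPiece (a + b)) (s - ρ) +
            fordLaplace₀ (quadPiece (a + 2 * b)) (s - ρ))‖ ≤
        κ * ((DirichletDisc.zeroOrder χ (ρ : ℂ) : ℝ) / (1 + ((ρ : ℂ).im - s.im) ^ 2)) := by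
    intro ρ
    have hρ := ρ.2
    have hρre : (ρ : ℂ).re = 1 / 2 := hG _ hρ.1 hρ.2.1 hρ.2.2
    have hzre : (s - ρ).re = d := by rw [sub_re, hρre, hd]
    have hzim : (s - ρ).im = s.im - (ρ : ℂ).im := by rw [sub_im]
    have hz0 : s - (ρ : ℂ) ≠ 0 := fun h ↦ by
      have := congrArg Complex.re h
      rw [hzre, Complex.zero_re] at this
      linarith
    have hm : (0 : ℝ) ≤ DirichletDisc.zeroOrder χ (ρ : ℂ) := Nat.cast_nonneg _
    have hk := norm_kernel_le (a := a) (b := b) hz0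
    rw [← comb_fordLaplace₀_eq ha hb hz0, hzre] at hk
    -- `‖z‖³ ≥ d·μ·(1 + (γ − t)²)`
    have hn2 : ‖s - (ρ : ℂ)‖ ^ 2 = d ^ 2 + ((ρ : ℂ).im - s.im) ^ 2 := by
      rw [Complex.sq_norm, Complex.normSq_apply, hzre, hzim]; ring
    have hnd : d ≤ ‖s - (ρ : ℂ)‖ := by rw [← hzre]; exact Complex.re_le_norm _
    have hlow : d * μ * (1 + ((ρ : ℂ).im - s.im) ^ 2) ≤ ‖s - (ρ : ℂ)‖ ^ 3 := by
      have h1 : μ * (1 + ((ρ : ℂ).im - s.im) ^ 2) ≤ d ^ 2 + ((ρ : ℂ).im - s.im) ^ 2 := by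
        have hμ1 : μ ≤ 1 := min_le_right _ _
        have hμ2 : μ ≤ d ^ 2 := min_le_left _ _
        nlinarith [sq_nonneg ((ρ : ℂ).im - s.im)]
      calc d * μ * (1 + ((ρ : ℂ).im - s.im) ^ 2) = d * (μ * (1 + ((ρ : ℂ).im - s.im) ^ 2)) := by ring
        _ ≤ ‖s - (ρ : ℂ)‖ * ‖s - (ρ : ℂ)‖ ^ 2 := by
            rw [hn2]; exact mul_le_mul hnd h1 (by positivity) (norm_nonneg _)
        _ = ‖s - (ρ : ℂ)‖ ^ 3 := by ring
    have heb : (1 + Real.exp (-(b * d))) ^ 2 ≤ 4 := by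
      have : Real.exp (-(b * d)) ≤ 1 := by rw [Real.exp_le_one_iff]; nlinarith
      nlinarith [Real.exp_pos (-(b * d))]
    have hE0 : 0 ≤ Real.exp (-(a * d)) := (Real.exp_pos _).le
    have hpos : 0 < d * μ * (1 + ((ρ : ℂ).im - s.im) ^ 2) := by positivity
    have hker : ‖fordLaplace₀ (quadPiece a) (s - ρ) - 2 * fordLaplace₀ (quadPiece (a + b)) (s - ρ) +
        fordLaplace₀ (quadPiece (a + 2 * b)) (s - ρ)‖ ≤ κ * (1 / (1 + ((ρ : ℂ).im - s.im) ^ 2)) := by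
      refine hk.trans ?_
      calc 2 * Real.exp (-(a * d)) * (1 + Real.exp (-(b * d))) ^ 2 / ‖s - (ρ : ℂ)‖ ^ 3
          ≤ 8 * Real.exp (-(a * d)) / ‖s - (ρ : ℂ)‖ ^ 3 := by
            refine div_le_div_of_nonneg_right ?_ (by positivity); nlinarith
        _ ≤ 8 * Real.exp (-(a * d)) / (d * μ * (1 + ((ρ : ℂ).im - s.im) ^ 2)) :=
            div_le_div_of_nonneg_left (by positivity) hpos hlow
        _ = κ * (1 / (1 + ((ρ : ℂ).im - s.im) ^ 2)) := by rw [hκ]; field_simp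
    rw [norm_mul, Complex.norm_natCast]
    calc (DirichletDisc.zeroOrder χ (ρ : ℂ) : ℝ) *
          ‖fordLaplace₀ (quadPiece a) (s - ρ) - 2 * fordLaplace₀ (quadPiece (a + b)) (s - ρ) +
            fordLaplace₀ (quadPiece (a + 2 * b)) (s - ρ)‖
        ≤ (DirichletDisc.zeroOrder χ (ρ : ℂ) : ℝ) * (κ * (1 / (1 + ((ρ : ℂ).im - s.im) ^ 2))) :=
          mul_le_mul_of_nonneg_left hker hm
      _ = κ * ((DirichletDisc.zeroOrder χ (ρ : ℂ) : ℝ) / (1 + ((ρ : ℂ).im - s.im) ^ 2)) := by ring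
  have hsn : Summable fun ρ : charNontrivialZeros χ ↦
      ‖(DirichletDisc.zeroOrder χ (ρ : ℂ) : ℂ) *
          (fordLaplace₀ (quadPiece a) (s - ρ) - 2 * fordLaplace₀ (quadPiece (a + b)) (s - ρ) +
            fordLaplace₀ (quadPiece (a + 2 * b)) (s - ρ))‖ :=
    Summable.of_nonneg_of_le (fun _ ↦ norm_nonneg _) hpt (hsumm.mul_left κ)
  calc _ ≤ ∑' ρ : charNontrivialZeros χ, ‖(DirichletDisc.zeroOrder χ (ρ : ℂ) : ℂ) *
          (fordLaplace₀ (quadPiece a) (s - ρ) - 2 * fordLaplace₀ (quadPiece (a + b)) (s - ρ) +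
            fordLaplace₀ (quadPiece (a + 2 * b)) (s - ρ))‖ := norm_tsum_le_tsum_norm hsn
    _ ≤ ∑' ρ : charNontrivialZeros χ,
          κ * ((DirichletDisc.zeroOrder χ (ρ : ℂ) : ℝ) / (1 + ((ρ : ℂ).im - s.im) ^ 2)) :=
        hsn.tsum_le_tsum hpt (hsumm.mul_left κ)
    _ = κ * ∑' ρ : charNontrivialZeros χ,
          (DirichletDisc.zeroOrder χ (ρ : ℂ) : ℝ) / (1 + ((ρ : ℂ).im - s.im) ^ 2) := tsum_mul_left

/-- A value of the two-scale kernel to the right of the imaginary axis and at height `≥ 3` is small: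
`‖kernel(z)‖ ≤ 8/27` for `Re z > 0`, `|Im z| ≥ 3` (`a, b ≥ 0`). [folklore] -/
private theorem norm_kernel_le_of_im {a b : ℝ} (ha : 0 ≤ a) (hb : 0 ≤ b) {z : ℂ} (hz : 0 < z.re)
    (hzi : 3 ≤ |z.im|) :
    ‖-2 * Complex.exp (-(z * a)) * (1 - Complex.exp (-(z * b))) ^ 2 / z ^ 3‖ ≤ 8 / 27 := by
  have hz0 : z ≠ 0 := fun h ↦ by rw [h, Complex.zero_re] at hz; exact lt_irrefl _ hz
  refine (norm_kernel_le hz0).trans ?_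
  have hea : Real.exp (-(a * z.re)) ≤ 1 := by rw [Real.exp_le_one_iff]; nlinarith
  have heb : (1 + Real.exp (-(b * z.re))) ^ 2 ≤ 4 := by
    have : Real.exp (-(b * z.re)) ≤ 1 := by rw [Real.exp_le_one_iff]; nlinarith
    nlinarith [Real.exp_pos (-(b * z.re))]
  have hn : (3 : ℝ) ≤ ‖z‖ := hzi.trans (Complex.abs_im_le_norm z)
  have hn3 : (27 : ℝ) ≤ ‖z‖ ^ 3 := by
    calc (27 : ℝ) = 3 ^ 3 := by norm_num
      _ ≤ ‖z‖ ^ 3 := pow_le_pow_left₀ (by norm_num) hn 3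
  have hnum : 2 * Real.exp (-(a * z.re)) * (1 + Real.exp (-(b * z.re))) ^ 2 ≤ 8 := by
    nlinarith [Real.exp_pos (-(a * z.re)), mul_le_mul hea heb (by positivity) zero_le_one]
  calc 2 * Real.exp (-(a * z.re)) * (1 + Real.exp (-(b * z.re))) ^ 2 / ‖z‖ ^ 3
      ≤ 8 / ‖z‖ ^ 3 := div_le_div_of_nonneg_right hnum (by positivity)
    _ ≤ 8 / 27 := div_le_div_of_nonneg_left (by norm_num) (by norm_num) hn3

/-- **The trivial zeros**: `‖Σ_τ m(τ) kernel(s − τ)‖ ≤ 16/27` for `Re s > 0`, `Im s ≥ 3` (`τ ∈ {0, −1, −2}`,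
simple). [cite: HeathBrown1992PLMS, Lemma 5.1] -/
theorem norm_trivialSum_le (hprim : χ.IsPrimitive) (hq : 1 < q) {a b : ℝ} (ha : 0 ≤ a) (hb : 0 ≤ b)
    {s : ℂ} (hs : 0 < s.re) (ht : 3 ≤ s.im) :
    ‖∑ τ ∈ charTrivialZeroFinset (ne_one_of_isPrimitive hprim hq), (DirichletDisc.zeroOrder χ τ : ℂ) *
        (fordLaplace₀ (quadPiece a) (s - τ) - 2 * fordLaplace₀ (quadPiece (a + b)) (s - τ) +
          fordLaplace₀ (quadPiece (a + 2 * b)) (s - τ))‖ ≤ 2 * (8 / 27) := by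
  simp_rw [← fordLaplace₀_twoScale ha hb]
  have hval : ∀ j : ℝ, 0 ≤ j →
      ‖fordLaplace₀ (fun u ↦ quadPiece a u - 2 * quadPiece (a + b) u + quadPiece (a + 2 * b) u) (s + j)‖ ≤
        8 / 27 := by
    intro j hj
    have hz0 : s + (j : ℂ) ≠ 0 := fun h ↦ by
      have := congrArg Complex.re h
      simp at this; linarith
    rw [fordLaplace₀_twoScale ha hb, comb_fordLaplace₀_eq ha hb hz0]
    exact norm_kernel_le_of_im ha hb (by simp; linarith) (by simp; rw [abs_of_pos (by linarith)]; exact ht)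
  have h0 := hval 0 le_rfl
  simp only [Complex.ofReal_zero, add_zero] at h0
  have h1 := hval 1 zero_le_one
  have h2 := hval 2 (by norm_num)
  simp only [Complex.ofReal_one] at h1
  have e2 : ((2 : ℝ) : ℂ) = 2 := by norm_num
  rw [e2] at h2
  exact norm_sum_trivial_le hprim hq (by norm_num) h0 h1 h2

/-- **The left-line remainder of the two-scale combination**: it equals `J_χ` of the combined smoothing
(`charEFRemainder χ (g_a − 2g_{a+b} + g_{a+2b})`), by linearity of the integral. [folklore] -/
private theorem comb_charEFRemainder_eq (hprim : χ.IsPrimitive) (hq : 1 < q) {a b : ℝ} (ha : 0 ≤ a) (hb : 0 ≤ b)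
    {s : ℂ} (hσ₁ : -(1 / 2) < s.re) :
    charEFRemainder χ (quadPiece a) s - 2 * charEFRemainder χ (quadPiece (a + b)) s +
        charEFRemainder χ (quadPiece (a + 2 * b)) s =
      charEFRemainder χ (fun u ↦ quadPiece a u - 2 * quadPiece (a + b) u + quadPiece (a + 2 * b) u) s := by
  have hI1 := integrable_charIntegrand_left hprim hq (isSmoothedEFTest_quadPiece ha) hσ₁
  have hI2 := integrable_charIntegrand_left hprim hq (isSmoothedEFTest_quadPiece (a := a + b) (by linarith)) hσ₁
  have hI3 := integrable_charIntegrand_left hprim hq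
    (isSmoothedEFTest_quadPiece (a := a + 2 * b) (by linarith)) hσ₁
  have heq : (fun y : ℝ ↦ charEFIntegrand χ
        (fun u ↦ quadPiece a u - 2 * quadPiece (a + b) u + quadPiece (a + 2 * b) u) s
        ((((-(5 / 2) : ℝ)) : ℂ) + y * I)) = fun y : ℝ ↦
      charEFIntegrand χ (quadPiece a) s ((((-(5 / 2) : ℝ)) : ℂ) + y * I) -
        2 * charEFIntegrand χ (quadPiece (a + b)) s ((((-(5 / 2) : ℝ)) : ℂ) + y * I) +
        charEFIntegrand χ (quadPiece (a + 2 * b)) s ((((-(5 / 2) : ℝ)) : ℂ) + y * I) := by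
    funext y
    simp only [charEFIntegrand, fordLaplace₀_twoScale ha hb]
    ring
  have h2 : Integrable fun y : ℝ ↦
      2 * charEFIntegrand χ (quadPiece (a + b)) s ((((-(5 / 2) : ℝ)) : ℂ) + y * I) := hI2.const_mul 2
  have h12 : Integrable fun y : ℝ ↦
      charEFIntegrand χ (quadPiece a) s ((((-(5 / 2) : ℝ)) : ℂ) + y * I) -
        2 * charEFIntegrand χ (quadPiece (a + b)) s ((((-(5 / 2) : ℝ)) : ℂ) + y * I) := hI1.sub h2
  simp only [charEFRemainder]
  rw [heq, integral_add h12 hI3, integral_sub hI1 h2, integral_const_mul]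
  ring

end Char

/-! ## E. Littlewood's bound under GRH(χ) -/

section Main

variable {q : ℕ} [NeZero q] {χ : DirichletCharacter ℂ q}

/-- **`L′/L(σ + it, χ) ≪ (log t)^{2−2σ}` under GRH(χ)** (Littlewood; the `χ`-analogue of Titchmarsh's
Theorem 14.5 (14.5.1), printed as Montgomery–Vaughan §13.2.1 Exercise 2 (b)): for a primitive `χ` mod
`q > 1` with `χ.RiemannHypothesis` and a fixed `½ < σ < 1` there is `C` (depending on `σ`, `q`) with
`‖L′/L(σ + it, χ)‖ ≤ C (log t)^{2−2σ}` for all `t ≥ 3`. Proof: Montgomery–Vaughan's two-scale explicit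
formula (`y = e^{1/(σ−½)}`, `x = 8^{1/(σ−½)}(log t)²`) on Heath-Brown's exact formula for `L(s, χ)`.
[cite: MontgomeryVaughan2007, §13.2.1 Exercise 2 (b); Thm 13.13] [cite: Titchmarsh1986, Thm 14.5 (14.5.1)] -/
theorem norm_logDeriv_LFunction_le_log_rpow (hprim : χ.IsPrimitive) (hq : 1 < q)
    (hG : χ.RiemannHypothesis) {σ : ℝ} (hσ : 1 / 2 < σ) (hσ1 : σ < 1) :
    ∃ C : ℝ, ∀ t : ℝ, 3 ≤ t →
      ‖deriv χ.LFunction (σ + t * I) / χ.LFunction (σ + t * I)‖ ≤ C * Real.log t ^ (2 - 2 * σ) := by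
  have hχ : χ ≠ 1 := ne_one_of_isPrimitive hprim hq
  obtain ⟨CJ, hCJ0, hCJ⟩ := exists_norm_charEFRemainder_le
  obtain ⟨CW, hCW0, hCW⟩ := exists_tsum_zeroOrder_div_shift_le
  obtain ⟨d, hd⟩ : ∃ d : ℝ, d = σ - 1 / 2 := ⟨_, rfl⟩
  have hd0 : 0 < d := by rw [hd]; linarith
  obtain ⟨b, hb⟩ : ∃ b : ℝ, b = 1 / d := ⟨_, rfl⟩
  have hb0 : 0 < b := by rw [hb]; positivity
  have h1σ : 0 < 1 - σ := by linarith
  have hlog8 : 0 < Real.log 8 := Real.log_pos (by norm_num)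
  obtain ⟨M₈, hM₈⟩ : ∃ M : ℝ, M = Real.exp (Real.log 8 / d) := ⟨_, rfl⟩
  have hM₈0 : 0 < M₈ := by rw [hM₈]; exact Real.exp_pos _
  obtain ⟨M, hM⟩ : ∃ M : ℝ, M = M₈ * Real.exp (2 * b) := ⟨_, rfl⟩
  have hM0 : 0 < M := by rw [hM]; positivity
  set μ : ℝ := min (d ^ 2) 1 with hμ
  have hμ0 : 0 < μ := lt_min (by positivity) one_pos
  have hq0 : 0 ≤ Real.log q := Real.log_natCast_nonneg q
  -- the constants of the four pieces
  set CK : ℝ := 2 * b ^ 2 * ((Real.log 4 + 4) * (2 * M) ^ (1 - σ) / (1 - σ)) with hCK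
  set CS : ℝ := CW * (Real.log q + 2) / (d * μ) with hCS
  set CT : ℝ := 2 * (8 / 27) with hCT
  set CJ' : ℝ := 8 * CJ * (Real.log q + 2) / (3 * M₈) with hCJ'
  have hCK0 : 0 ≤ CK := by positivity
  have hCS0 : 0 ≤ CS := by positivity
  have hCT0 : 0 ≤ CT := by norm_num
  have hCJ'0 : 0 ≤ CJ' := by positivity
  refine ⟨(CK + CS + CT + CJ') / (2 * b ^ 2), fun t ht ↦ ?_⟩
  have ht0 : 0 < t := by linarith
  have hexp1 : Real.exp 1 < 3 := lt_trans Real.exp_one_lt_d9 (by norm_num)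
  have hL1 : 1 ≤ Real.log t := by
    rw [Real.le_log_iff_exp_le ht0]; linarith
  have hL0 : 0 < Real.log t := by linarith
  have hLL0 : 0 ≤ Real.log (Real.log t) := Real.log_nonneg hL1
  set e : ℝ := 2 - 2 * σ with he
  have he0 : 0 ≤ e := by rw [he]; linarith
  have hLe1 : 1 ≤ Real.log t ^ e := Real.one_le_rpow hL1 he0
  have hL2e : (Real.log t ^ 2) ^ (1 - σ) = Real.log t ^ e := by
    rw [← Real.rpow_natCast (Real.log t) 2, ← Real.rpow_mul hL0.le]
    congr 1; rw [he]; push_cast; ring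
  have hlog2 : Real.log 2 < 1 := lt_trans Real.log_two_lt_d9 (by norm_num)
  have hlogt4 : Real.log (t + 4) ≤ 2 * Real.log t := by
    have : Real.log (t + 4) ≤ Real.log (t ^ 2) := Real.log_le_log (by linarith) (by nlinarith)
    rwa [Real.log_pow, Nat.cast_ofNat] at this
  have hlog1t : Real.log (1 + t) ≤ 2 * Real.log t := by
    have : Real.log (1 + t) ≤ Real.log (2 * t) := Real.log_le_log (by linarith) (by linarith)
    rw [Real.log_mul (by norm_num) ht0.ne'] at this
    linarith
  have hlog1t0 : 0 ≤ Real.log (1 + t) := Real.log_nonneg (by linarith)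
  -- the two-scale parameters
  obtain ⟨a, ha⟩ : ∃ a : ℝ, a = Real.log 8 / d + 2 * Real.log (Real.log t) := ⟨_, rfl⟩
  have ha0 : 0 ≤ a := by rw [ha]; positivity
  have hexp2 : Real.exp (2 * Real.log (Real.log t)) = Real.log t ^ 2 := by
    rw [show 2 * Real.log (Real.log t) = Real.log (Real.log t) + Real.log (Real.log t) by ring,
      Real.exp_add, Real.exp_log hL0]; ring
  have hea : Real.exp a = M₈ * Real.log t ^ 2 := by
    rw [ha, Real.exp_add, hM₈, hexp2]
  have head : 8 * Real.exp (-(a * d)) = Real.log t ^ (-(2 * d)) := by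
    have e1 : -(a * d) = -Real.log 8 + Real.log (Real.log t) * (-(2 * d)) := by
      rw [ha]; field_simp; ring
    rw [e1, Real.exp_add, Real.exp_neg, Real.exp_log (by norm_num : (0 : ℝ) < 8),
      ← Real.rpow_def_of_pos hL0]
    ring
  have hea2b : Real.exp (a + 2 * b) = M * Real.log t ^ 2 := by
    rw [Real.exp_add, hea, hM]; ring
  have hpe : Real.log t ^ (-(2 * d)) * Real.log t = Real.log t ^ e := by
    rw [← Real.rpow_add_one hL0.ne']
    congr 1; rw [he, hd]; ring
  -- the point
  set s : ℂ := σ + t * I with hs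
  have hsre : s.re = σ := by simp [hs]
  have hsim : s.im = t := by simp [hs]
  have hLs : χ.LFunction s ≠ 0 :=
    Lagarias2005Char.LFunction_ne_zero_of_rh hχ hG (by rw [hsre]; exact hσ)
  have heq := explicit_formula_twoScale hprim hq ha0 hb0.le (s := s) (by rw [hsre]; linarith)
    (by rw [hsre]; linarith) hLs
  set Z := deriv χ.LFunction s / χ.LFunction s with hZ
  set Kc := charFordK χ (quadPiece a) s - 2 * charFordK χ (quadPiece (a + b)) s +
    charFordK χ (quadPiece (a + 2 * b)) s with hKc
  set Sc := ∑' ρ : charNontrivialZeros χ, (DirichletDisc.zeroOrder χ (ρ : ℂ) : ℂ) *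
    (fordLaplace₀ (quadPiece a) (s - ρ) - 2 * fordLaplace₀ (quadPiece (a + b)) (s - ρ) +
      fordLaplace₀ (quadPiece (a + 2 * b)) (s - ρ)) with hSc
  set Tc := ∑ τ ∈ charTrivialZeroFinset (ne_one_of_isPrimitive hprim hq),
    (DirichletDisc.zeroOrder χ τ : ℂ) *
      (fordLaplace₀ (quadPiece a) (s - τ) - 2 * fordLaplace₀ (quadPiece (a + b)) (s - τ) +
        fordLaplace₀ (quadPiece (a + 2 * b)) (s - τ)) with hTc
  set Jc := charEFRemainder χ (quadPiece a) s - 2 * charEFRemainder χ (quadPiece (a + b)) s +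
    charEFRemainder χ (quadPiece (a + 2 * b)) s with hJc
  -- the triangle inequality
  have htri : 2 * b ^ 2 * ‖Z‖ ≤ ‖Kc‖ + ‖Sc‖ + ‖Tc‖ + ‖Jc‖ := by
    have e1 : 2 * b ^ 2 * ‖Z‖ = ‖2 * (b : ℂ) ^ 2 * Z‖ := by
      rw [norm_mul, norm_mul, Complex.norm_ofNat, norm_pow, Complex.norm_real, Real.norm_eq_abs,
        abs_of_pos hb0]
    rw [e1, heq]
    calc ‖-Kc - Sc - Tc + Jc‖ ≤ ‖-Kc - Sc - Tc‖ + ‖Jc‖ := norm_add_le _ _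
      _ ≤ ‖-Kc - Sc‖ + ‖Tc‖ + ‖Jc‖ := by gcongr; exact norm_sub_le _ _
      _ ≤ ‖-Kc‖ + ‖Sc‖ + ‖Tc‖ + ‖Jc‖ := by gcongr; exact norm_sub_le _ _
      _ = ‖Kc‖ + ‖Sc‖ + ‖Tc‖ + ‖Jc‖ := by rw [norm_neg]
  -- (1) the Dirichlet polynomial
  have hK : ‖Kc‖ ≤ CK * Real.log t ^ e := by
    set N : ℕ := ⌊Real.exp (a + 2 * b)⌋₊ + 1 with hN
    have hN1 : 1 ≤ N := by rw [hN]; omega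
    have hNpos : (0 : ℝ) < N := by exact_mod_cast hN1
    have hNle : (N : ℝ) ≤ 2 * (M * Real.log t ^ 2) := by
      rw [← hea2b, hN]
      push_cast
      have h1 := Nat.floor_le (Real.exp_pos (a + 2 * b)).le
      have h2 : 1 ≤ Real.exp (a + 2 * b) := Real.one_le_exp (by positivity)
      linarith
    have hNge : Real.exp (a + 2 * b) ≤ N := by
      rw [hN]; push_cast; exact (Nat.lt_floor_add_one _).le
    have hlogN : a + 2 * b ≤ Real.log N := by
      rw [Real.le_log_iff_exp_le hNpos]; exact hNge
    have h1 := norm_comb_charFordK_le χ (a := a) hb0 s hN1 hlogN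
    rw [hsre] at h1
    have h2 := sum_range_vonMangoldt_mul_rpow_le (by linarith : 0 < σ) hσ1 N
    have h3 : (N : ℝ) ^ (1 - σ) ≤ (2 * M) ^ (1 - σ) * Real.log t ^ e := by
      calc (N : ℝ) ^ (1 - σ) ≤ (2 * (M * Real.log t ^ 2)) ^ (1 - σ) :=
            Real.rpow_le_rpow hNpos.le hNle h1σ.le
        _ = (2 * M) ^ (1 - σ) * (Real.log t ^ 2) ^ (1 - σ) := by
            rw [show 2 * (M * Real.log t ^ 2) = (2 * M) * Real.log t ^ 2 by ring,
              Real.mul_rpow (by positivity) (by positivity)]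
        _ = (2 * M) ^ (1 - σ) * Real.log t ^ e := by rw [hL2e]
    have hc4 : 0 < Real.log 4 + 4 := by have := Real.log_pos (by norm_num : (1 : ℝ) < 4); linarith
    calc ‖Kc‖ ≤ 2 * b ^ 2 * ∑ n ∈ Finset.range N,
          (ArithmeticFunction.vonMangoldt n : ℝ) * (n : ℝ) ^ (-σ) := h1
      _ ≤ 2 * b ^ 2 * ((Real.log 4 + 4) * (N : ℝ) ^ (1 - σ) / (1 - σ)) :=
          mul_le_mul_of_nonneg_left h2 (by positivity)
      _ ≤ 2 * b ^ 2 * ((Real.log 4 + 4) * ((2 * M) ^ (1 - σ) * Real.log t ^ e) / (1 - σ)) := by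
          gcongr
      _ = CK * Real.log t ^ e := by rw [hCK]; ring
  -- (2) the zeros
  have hS : ‖Sc‖ ≤ CS * Real.log t ^ e := by
    obtain ⟨hsumW, hW⟩ := hCW q χ hprim hq t
    rw [abs_of_pos ht0] at hW
    have hsumW' : Summable (fun ρ : charNontrivialZeros χ ↦
        (DirichletDisc.zeroOrder χ (ρ : ℂ) : ℝ) / (1 + ((ρ : ℂ).im - s.im) ^ 2)) := by
      rw [hsim]; exact hsumW
    have h1 := norm_zeroSum_le hG ha0 hb0.le (s := s) (by rw [hsre]; exact hσ) hsumW'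
    rw [hsim, hsre, ← hd] at h1
    have hlin : Real.log q + Real.log (t + 4) ≤ (Real.log q + 2) * Real.log t := by
      have := mul_le_mul_of_nonneg_left hL1 hq0
      linarith only [this, hlogt4]
    calc ‖Sc‖ ≤ 8 * Real.exp (-(a * d)) / (d * min (d ^ 2) 1) *
          ∑' ρ : charNontrivialZeros χ,
            (DirichletDisc.zeroOrder χ (ρ : ℂ) : ℝ) / (1 + ((ρ : ℂ).im - t) ^ 2) := h1
      _ = Real.log t ^ (-(2 * d)) / (d * μ) *
          ∑' ρ : charNontrivialZeros χ,
            (DirichletDisc.zeroOrder χ (ρ : ℂ) : ℝ) / (1 + ((ρ : ℂ).im - t) ^ 2) := by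
          rw [← head]
      _ ≤ Real.log t ^ (-(2 * d)) / (d * μ) * (CW * ((Real.log q + 2) * Real.log t)) := by
          refine mul_le_mul_of_nonneg_left (hW.trans ?_) (by positivity)
          exact mul_le_mul_of_nonneg_left hlin hCW0.le
      _ = CS * (Real.log t ^ (-(2 * d)) * Real.log t) := by rw [hCS]; ring
      _ = CS * Real.log t ^ e := by rw [hpe]
  -- (3) the trivial zeros
  have hT : ‖Tc‖ ≤ CT * Real.log t ^ e := by
    have h1 := norm_trivialSum_le hprim hq ha0 hb0.le (s := s) (by rw [hsre]; linarith)
      (by rw [hsim]; exact ht)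
    calc ‖Tc‖ ≤ 2 * (8 / 27) := h1
      _ = CT * 1 := by rw [hCT]; ring
      _ ≤ CT * Real.log t ^ e := mul_le_mul_of_nonneg_left hLe1 hCT0
  -- (4) the left-line remainder
  have hJ : ‖Jc‖ ≤ CJ' * Real.log t ^ e := by
    rw [hJc, comb_charEFRemainder_eq hprim hq ha0 hb0.le (s := s) (by rw [hsre]; linarith)]
    set B : ℝ := 8 * Real.exp (-(a * (σ + 5 / 2))) / (σ + 5 / 2) with hB
    have hB0 : 0 ≤ B := by positivity
    have hker : ∀ y : ℝ,
        ‖fordLaplace₀ (fun u ↦ quadPiece a u - 2 * quadPiece (a + b) u + quadPiece (a + 2 * b) u)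
          (s - ((((-(5 / 2) : ℝ)) : ℂ) + y * I))‖ ≤ B / ((s.re + 5 / 2) ^ 2 + (s.im - y) ^ 2) := by
      intro y
      set z : ℂ := s - ((((-(5 / 2) : ℝ)) : ℂ) + y * I) with hz
      have hzre : z.re = σ + 5 / 2 := by rw [hz, sub_re, hsre]; norm_num
      have hzim : z.im = t - y := by rw [hz, sub_im, hsim]; simp
      have hzre0 : 0 < z.re := by rw [hzre]; linarith
      have hz0 : z ≠ 0 := fun h ↦ by rw [h, Complex.zero_re] at hzre0; exact lt_irrefl _ hzre0
      rw [fordLaplace₀_twoScale ha0 hb0.le, comb_fordLaplace₀_eq ha0 hb0.le hz0, hsre, hsim]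
      refine (norm_kernel_le_right (a := a) hb0.le hzre0).trans (le_of_eq ?_)
      rw [hzre, hzim, hB]
    have h1 := hCJ q χ hprim hq _ s B hB0 (by rw [hsre]; linarith) hker
    rw [hsim, abs_of_pos ht0] at h1
    have hBle : B ≤ 8 / 3 * (M₈ * Real.log t ^ 2)⁻¹ := by
      rw [hB, ← hea, ← Real.exp_neg]
      have h3 : (3 : ℝ) ≤ σ + 5 / 2 := by linarith
      have hex : Real.exp (-(a * (σ + 5 / 2))) ≤ Real.exp (-a) := by
        rw [Real.exp_le_exp]
        have := mul_le_mul_of_nonneg_left (show (1 : ℝ) ≤ σ + 5 / 2 by linarith only [hσ]) ha0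
        linarith only [this]
      calc 8 * Real.exp (-(a * (σ + 5 / 2))) / (σ + 5 / 2)
          ≤ 8 * Real.exp (-(a * (σ + 5 / 2))) / 3 :=
            div_le_div_of_nonneg_left (by positivity) (by norm_num) h3
        _ = 8 / 3 * Real.exp (-(a * (σ + 5 / 2))) := by ring
        _ ≤ 8 / 3 * Real.exp (-a) := mul_le_mul_of_nonneg_left hex (by norm_num)
    have hlin : Real.log q + Real.log (1 + t) ≤ (Real.log q + 2) * Real.log t := by
      have := mul_le_mul_of_nonneg_left hL1 hq0
      linarith only [this, hlog1t]
    have hX0 : 0 ≤ Real.log q + Real.log (1 + t) := add_nonneg hq0 hlog1t0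
    calc ‖charEFRemainder χ
          (fun u ↦ quadPiece a u - 2 * quadPiece (a + b) u + quadPiece (a + 2 * b) u) s‖
        ≤ CJ * B * (Real.log q + Real.log (1 + t)) := h1
      _ ≤ CJ * (8 / 3 * (M₈ * Real.log t ^ 2)⁻¹) * ((Real.log q + 2) * Real.log t) :=
          mul_le_mul (mul_le_mul_of_nonneg_left hBle hCJ0.le) hlin hX0 (by positivity)
      _ = CJ' * (1 / Real.log t) * (Real.log t * (Real.log t)⁻¹) := by
          rw [hCJ', mul_inv, pow_two, mul_inv]; ring
      _ = CJ' * (1 / Real.log t) := by rw [mul_inv_cancel₀ hL0.ne', mul_one]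
      _ ≤ CJ' * Real.log t ^ e := by
          refine mul_le_mul_of_nonneg_left ?_ hCJ'0
          calc 1 / Real.log t ≤ 1 := by rw [div_le_one hL0]; exact hL1
            _ ≤ Real.log t ^ e := hLe1
  -- assemble
  have hb2 : 0 < 2 * b ^ 2 := by positivity
  rw [div_mul_eq_mul_div, le_div_iff₀ hb2]
  linarith only [htri, hK, hS, hT, hJ]

end Main

/-! ## F. Both signs of `t` (conjugation `χ ↦ χ̄`) -/

section TwoSided

open ComplexConjugate

variable {q : ℕ} [NeZero q] {χ : DirichletCharacter ℂ q}

/-- The Riemann hypothesis for `L(s, χ)` is inherited by `χ̄ = χ⁻¹` (`χ ≠ 1`): the zeros of `L(·, χ⁻¹)`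
are the complex conjugates of those of `L(·, χ)` (`DirichletZFR.conj_LFunction_conj`). [folklore] -/
private theorem riemannHypothesis_inv (hχ : χ ≠ 1) (hG : χ.RiemannHypothesis) :
    χ⁻¹.RiemannHypothesis := by
  intro s hs h0 h1
  have h := DirichletZFR.conj_LFunction_conj χ hχ s
  rw [hs, map_eq_zero] at h
  have := hG (conj s) h (by simpa using h0) (by simpa using h1)
  simpa using this

/-- **Both signs of `t`**: under GRH(χ), for a primitive `χ` mod `q > 1` and fixed `½ < σ < 1`,
`‖L′/L(σ + it, χ)‖ ≤ C (log|t|)^{2−2σ}` for all `|t| ≥ 3` — the case `t ≤ −3` from the case `t ≥ 3` for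
`χ̄` via `(L′/L)(s̄, χ) = conj (L′/L)(s, χ̄)` (`DirichletTheta.logDeriv_LFunction_conj`).
[cite: MontgomeryVaughan2007, §13.2.1 Exercise 2 (b)] -/
theorem norm_logDeriv_LFunction_le_log_rpow_abs (hprim : χ.IsPrimitive) (hq : 1 < q)
    (hG : χ.RiemannHypothesis) {σ : ℝ} (hσ : 1 / 2 < σ) (hσ1 : σ < 1) :
    ∃ C : ℝ, ∀ t : ℝ, 3 ≤ |t| →
      ‖deriv χ.LFunction (σ + t * I) / χ.LFunction (σ + t * I)‖ ≤ C * Real.log |t| ^ (2 - 2 * σ) := by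
  have hχ : χ ≠ 1 := ne_one_of_isPrimitive hprim hq
  obtain ⟨C₁, hC₁⟩ := norm_logDeriv_LFunction_le_log_rpow hprim hq hG hσ hσ1
  obtain ⟨C₂, hC₂⟩ := norm_logDeriv_LFunction_le_log_rpow (χ := χ⁻¹)
    (SelbergDirichlet.isPrimitive_inv hprim) hq (riemannHypothesis_inv hχ hG) hσ hσ1
  refine ⟨max C₁ C₂, fun t ht ↦ ?_⟩
  have hlog0 : 0 ≤ Real.log |t| ^ (2 - 2 * σ) :=
    Real.rpow_nonneg (Real.log_nonneg (by linarith)) _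
  rcases le_or_gt 0 t with h0 | h0
  · rw [abs_of_nonneg h0] at ht hlog0 ⊢
    exact (hC₁ t ht).trans (mul_le_mul_of_nonneg_right (le_max_left _ _) hlog0)
  · have ht' : 3 ≤ -t := by rwa [abs_of_neg h0] at ht
    have e : (σ : ℂ) + t * I = conj ((σ : ℂ) + ((-t : ℝ) : ℂ) * I) := by
      apply Complex.ext <;> simp
    rw [abs_of_neg h0] at hlog0 ⊢
    rw [← logDeriv_apply, e, DirichletTheta.logDeriv_LFunction_conj hχ, Complex.norm_conj,
      logDeriv_apply]
    exact (hC₂ (-t) ht').trans (mul_le_mul_of_nonneg_right (le_max_right _ _) hlog0)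

/-- **The GRH-side input of Lagarias 2005, Theorem 5.2 (2), in the `o(log|t|)` form its proof uses**
(Lagarias: "`|L′/L(½ + h + it, χ)| = O((log|T|)^{2−2σ})` … from a result of Iwaniec and Kowalski",
arXiv p. 10): under GRH(χ), for a primitive `χ ≠ 1` mod `N` and `0 < h < ½`, for every `η > 0` there is
`T₀` with `‖L′/L(½ + h + it, χ)‖ ≤ η log|t|` for all `|t| ≥ T₀` (from
`norm_logDeriv_LFunction_le_log_rpow_abs`: `(log|t|)^{1−2h} ≤ (η/C)(log|t|)` once
`log|t| ≥ (C/η)^{1/(2h)}`). Stated with explicit binders in the order of the hypothesis `hL₃` of the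
R14 closer `lagarias2005_thm_5_2_2_of_logDeriv`, which it discharges.
[cite: Lagarias2005, proof of Theorem 5.2 (2) (arXiv p. 10)] [cite: MontgomeryVaughan2007, §13.2.1 Exercise 2 (b)] -/
theorem norm_logDeriv_LFunction_le_mul_log_of_rh (N : ℕ) [NeZero N] (χ : DirichletCharacter ℂ N)
    (hprim : χ.IsPrimitive) (h1 : χ ≠ 1) (hG : χ.RiemannHypothesis) (h : ℝ) (hh0 : 0 < h)
    (hh : h < 1 / 2) (η : ℝ) (hη : 0 < η) :
    ∃ T₀ : ℝ, ∀ t : ℝ, T₀ ≤ |t| →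
      ‖deriv χ.LFunction (1 / 2 + h + t * I) / χ.LFunction (1 / 2 + h + t * I)‖ ≤
        η * Real.log |t| := by
  have hN : 1 < N := by
    rcases Nat.lt_or_ge 1 N with hlt | hle
    · exact hlt
    · exfalso
      have hN1 : N = 1 := le_antisymm hle (Nat.one_le_iff_ne_zero.2 (NeZero.ne N))
      subst hN1
      exact h1 (DirichletCharacter.level_one χ)
  obtain ⟨C, hC⟩ := norm_logDeriv_LFunction_le_log_rpow_abs hprim hN hG (σ := 1 / 2 + h)
    (by linarith) (by linarith)
  have he : (2 : ℝ) - 2 * (1 / 2 + h) = 1 - 2 * h := by ring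
  rw [he] at hC
  set C' : ℝ := max C 1 with hC'
  have hC'0 : 0 < C' := lt_of_lt_of_le one_pos (le_max_right _ _)
  have h2h : 0 < 2 * h := by linarith
  set X : ℝ := (C' / η) ^ (1 / (2 * h)) with hX
  have hX0 : 0 ≤ X := Real.rpow_nonneg (by positivity) _
  refine ⟨max 3 (Real.exp X), fun t ht ↦ ?_⟩
  have ht3 : 3 ≤ |t| := (le_max_left _ _).trans ht
  have htX : Real.exp X ≤ |t| := (le_max_right _ _).trans ht
  have ht0 : 0 < |t| := by linarith
  have hL0 : 0 < Real.log |t| := Real.log_pos (by linarith)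
  have hLX : X ≤ Real.log |t| := by rw [Real.le_log_iff_exp_le ht0]; exact htX
  have hpow : C' ≤ η * Real.log |t| ^ (2 * h) := by
    have h2 : X ^ (2 * h) ≤ Real.log |t| ^ (2 * h) := Real.rpow_le_rpow hX0 hLX h2h.le
    rw [hX, ← Real.rpow_mul (by positivity), one_div_mul_cancel h2h.ne', Real.rpow_one,
      div_le_iff₀' hη] at h2
    exact h2
  have e : ((1 / 2 + h : ℝ) : ℂ) + t * I = 1 / 2 + h + t * I := by push_cast; ring
  have h1' := hC t ht3
  rw [e] at h1'
  have hr0 : 0 ≤ Real.log |t| ^ (1 - 2 * h) := Real.rpow_nonneg hL0.le _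
  calc ‖deriv χ.LFunction (1 / 2 + h + t * I) / χ.LFunction (1 / 2 + h + t * I)‖
      ≤ C * Real.log |t| ^ (1 - 2 * h) := h1'
    _ ≤ C' * Real.log |t| ^ (1 - 2 * h) := mul_le_mul_of_nonneg_right (le_max_left _ _) hr0
    _ ≤ η * Real.log |t| ^ (2 * h) * Real.log |t| ^ (1 - 2 * h) :=
        mul_le_mul_of_nonneg_right hpow hr0
    _ = η * Real.log |t| := by
        rw [mul_assoc, ← Real.rpow_add hL0, show 2 * h + (1 - 2 * h) = 1 by ring, Real.rpow_one]

end TwoSided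

end LittlewoodGRH

end Literature.NumberTheory.LFunctions
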